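import Summits.MatrixMultiplication.OmegaCensus.HeisenbergClassification

/-!
# ω-census, family (b3): conjecture C9 — the Heisenberg-type groups `p^{1+2n}` (all `p ≥ 3`, all `n ≥ 1`) are not box-useful

HONEST FRAMING (pub-omega census; verbatim): lottery ticket; floor = certified bounds/negative ranges.
Census BOOKKEEPING (conjecture C9 of the cell; pub-omega stpp-1 gen 19).  A computable model `ESp p n` of the higher Heisenberg group
`H_{2n+1}(ℤ/p)`: `(u, v, c) ∈ (ℤ/p)^n × (ℤ/p)^n × ℤ/p` with `(u,v,c)(u',v',c') = (u+u', v+v', c+c'+u·v')` (group axioms PROVED for every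
`p, n`; order `p^{2n+1}`; for odd prime `p` this is the extraspecial group `p^{1+2n}_+` of exponent `p`, centre `{(0,0,c)}` of index
`p^{2n}`).  The first coordinate embedding `Heis p ↪ ESp p (m+1)`, `⟨a,b,c⟩ ↦ (a·e₀, b·e₀, c)` is an injective homomorphism
(`toESp`, `toESp_injective`), so by `HeisenbergClassification` (`Heis.not_boxUseful_of_injective_heis'`, every `p ≥ 3`):
**`not_boxUseful_esp : 3 ≤ p → ¬ BoxUseful (ESp p (m+1))`** — a two-parameter infinite family, FORCED by its member `He_p` (C9 (a)),
consistent with C9 (b) (`[G : Z(G)] = p^{2n} ∉ {1,4,6}`).  (`p = 2`: `ESp 2 1 ≅ D₈` is useful; `2^{1+4}_+` is `BoxBadExtraspecial32`.)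
Nothing here is progress on `ω`.
-/

namespace Summit.MatrixMultiplication.OmegaCensus

open Finset ProductBoxBound Matrix

/-- Higher Heisenberg group over `ℤ/p`: `(u, v, c)` with `(u,v,c)(u',v',c') = (u+u', v+v', c+c'+u·v')`. [folklore] -/
structure ESp (p n : ℕ) where
  /-- first vector -/
  u : Fin n → ZMod p
  /-- second vector -/
  v : Fin n → ZMod p
  /-- central coordinate -/
  c : ZMod p

namespace ESp

variable {p n : ℕ}

/-- Two elements agree iff all coordinates agree. [folklore] -/
@[ext] theorem ext {x y : ESp p n} (hu : x.u = y.u) (hv : x.v = y.v) (hc : x.c = y.c) : x = y := by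
  cases x; cases y; congr

/-- Equality is decidable (coordinatewise). [folklore] -/
instance : DecidableEq (ESp p n) := fun x y =>
  decidable_of_iff (x.u = y.u ∧ x.v = y.v ∧ x.c = y.c) ⟨fun h => ext h.1 h.2.1 h.2.2, fun h => by subst h; exact ⟨rfl, rfl, rfl⟩⟩

/-- Product with cocycle `u · v'`. [folklore] -/
instance : Mul (ESp p n) := ⟨fun x y => ⟨x.u + y.u, x.v + y.v, x.c + y.c + x.u ⬝ᵥ y.v⟩⟩
/-- Identity. [folklore] -/
instance : One (ESp p n) := ⟨⟨0, 0, 0⟩⟩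
/-- Inverse `(u,v,c)⁻¹ = (−u, −v, −c + u·v)`. [folklore] -/
instance : Inv (ESp p n) := ⟨fun x => ⟨-x.u, -x.v, -x.c + x.u ⬝ᵥ x.v⟩⟩

/-- The multiplication rule, unfolded. [folklore] -/
theorem mul_def (x y : ESp p n) : x * y = ⟨x.u + y.u, x.v + y.v, x.c + y.c + x.u ⬝ᵥ y.v⟩ := rfl
/-- The identity, unfolded. [folklore] -/
theorem one_def : (1 : ESp p n) = ⟨0, 0, 0⟩ := rfl
/-- The inverse, unfolded. [folklore] -/
theorem inv_def (x : ESp p n) : x⁻¹ = ⟨-x.u, -x.v, -x.c + x.u ⬝ᵥ x.v⟩ := rfl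

/-- `ESp p n` is a group (axioms from bilinearity of the dot product). [folklore] -/
instance : Group (ESp p n) :=
  Group.ofLeftAxioms
    (fun x y z => ext (by simp only [mul_def]; abel) (by simp only [mul_def]; abel)
      (by simp only [mul_def, add_dotProduct, dotProduct_add]; abel))
    (fun x => ext (by simp only [mul_def, one_def, zero_add]) (by simp only [mul_def, one_def, zero_add])
      (by simp only [mul_def, one_def, zero_dotProduct, zero_add, add_zero]))
    (fun x => ext (by simp only [mul_def, inv_def, one_def, neg_add_cancel])
      (by simp only [mul_def, inv_def, one_def, neg_add_cancel])
      (by simp only [mul_def, inv_def, one_def, neg_dotProduct]; abel))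

/-- `ESp p n ≃ (ℤ/p)^n × (ℤ/p)^n × ℤ/p` as types. [folklore] -/
def equivProd : ESp p n ≃ (Fin n → ZMod p) × (Fin n → ZMod p) × ZMod p :=
  ⟨fun x => (x.u, x.v, x.c), fun q => ⟨q.1, q.2.1, q.2.2⟩, fun _ => rfl, fun _ => rfl⟩

/-- Finite, through `equivProd`. [folklore] -/
instance [NeZero p] : Fintype (ESp p n) := Fintype.ofEquiv _ equivProd.symm

/-- `|ESp p n| = p^n · p^n · p = p^{2n+1}`. [folklore] -/
theorem card [NeZero p] : Fintype.card (ESp p n) = p ^ n * (p ^ n * p) := by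
  rw [Fintype.ofEquiv_card, Fintype.card_prod, Fintype.card_prod, Fintype.card_fun, ZMod.card, Fintype.card_fin]

/-- The central coordinate is central: `(0,0,c)` commutes with everything. [folklore] -/
theorem central_comm (c : ZMod p) (x : ESp p n) : (⟨0, 0, c⟩ : ESp p n) * x = x * ⟨0, 0, c⟩ :=
  ext (by simp only [mul_def, zero_add, add_zero]) (by simp only [mul_def, zero_add, add_zero])
    (by simp only [mul_def, zero_dotProduct, dotProduct_zero, add_zero]; ring)

/-- **The embedding of the Heisenberg group** in the first coordinate: `⟨a,b,c⟩ ↦ (a·e₀, b·e₀, c)`. [folklore] -/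
def toESp (p m : ℕ) : Heis p →* ESp p (m + 1) where
  toFun x := ⟨Pi.single 0 x.a, Pi.single 0 x.b, x.c⟩
  map_one' := ext (by simp only [Heis.one_def, Pi.single_zero, one_def]) (by simp only [Heis.one_def, Pi.single_zero, one_def])
    (by simp only [Heis.one_def, one_def])
  map_mul' x y := ext (by simp only [Heis.mul_def, mul_def, Pi.single_add]) (by simp only [Heis.mul_def, mul_def, Pi.single_add])
    (by simp only [Heis.mul_def, mul_def, single_dotProduct, Pi.single_eq_same])

/-- The embedding is injective. [folklore] -/
theorem toESp_injective (p m : ℕ) : Function.Injective (toESp p m) := by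
  intro x y h
  have hu := congrArg ESp.u h
  have hv := congrArg ESp.v h
  have hc := congrArg ESp.c h
  simp only [toESp, MonoidHom.coe_mk, OneHom.coe_mk] at hu hv hc
  have ha := congrFun hu 0
  have hb := congrFun hv 0
  simp only [Pi.single_eq_same] at ha hb
  exact Heis.ext ha hb hc

/-- **`ESp p (m+1)` (order `p^{2m+3}`; for odd prime `p` the extraspecial group `p^{1+2(m+1)}_+`) is not box-useful for every
`p ≥ 3`**: it contains `Heis p`. [folklore] -/
theorem not_boxUseful_esp [NeZero p] (h3 : 3 ≤ p) (m : ℕ) : ¬ BoxUseful (ESp p (m + 1)) :=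
  Heis.not_boxUseful_of_injective_heis' h3 (toESp p m) (toESp_injective p m)

/-- No finite group containing some `ESp p (m+1)`, `p ≥ 3`, is box-useful. [folklore] -/
theorem not_boxUseful_of_injective_esp [NeZero p] (h3 : 3 ≤ p) (m : ℕ) {G : Type*} [Group G] [Fintype G]
    [DecidableEq G] (f : ESp p (m + 1) →* G) (hf : Function.Injective f) : ¬ BoxUseful G :=
  Heis.not_boxUseful_of_injective_heis' h3 (f.comp (toESp p m)) (hf.comp (toESp_injective p m))

end ESp

end Summit.MatrixMultiplication.OmegaCensus
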